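import Summits.QuantumFields.YangMills.Theorems.BalabanUVNodesN15KingModelPotentialLogDet

/-!
# N15 (NE2) King-model rung, PART 44 — THE η-RATE OF THE FREE-ENERGY DENSITY ITSELF (real coupling): `|f_{k+1}(t) − f_k(t)| ≤ A·(L^{−1∕2})^k`
# UNIFORMLY IN THE VOLUME, hence a `k → ∞` limit of the Gaussian free energy per site with a volume-uniform geometric tail

Eleventh generation (g11) of the seat `pub-ymgap-dag-n15-d`, part 44 (on 41 `…PotentialLogDet`; real analysis only — 10e `dressedLeaves_fullPert`, part 5
`inv_entry_decay_of_leaves`, the Literature Jacobi formula `LogDetDerivative.hasDerivAt_real_log_det` and Mathlib's mean-value inequality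
`norm_image_sub_le_of_norm_deriv_le_segment_01'`).  For the INTENSIVE quantity `f_k(t) = |Λ|⁻¹·log det(Δ^{(k)}_{t·v} + aL⁻²Q*Q)` (41): interpolate the two
levels, `M_s = (1−s)Δ^{(k)}_{t·v} + sΔ^{(k+1)}_{t·v} + aL⁻²Q*Q`, `s ∈ [0,1]`.  Convex combinations keep the socket's letters ((H1) coercivity is linear in the
operator, (H2) the Combes–Thomas budgets are convex), so `M_s⁻¹` has volume-uniform row sums (Combes–Thomas + the lattice-sum profile); Jacobi gives
`d∕ds log det M_s = tr(M_s⁻¹(Δ^{(k+1)} − Δ^{(k)}))`, bounded by `|Λ|·(row sum)·sup|Δ^{(k+1)}_{t·v} − Δ^{(k)}_{t·v}|`, and the last factor is the dressed leaf (H3)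
`≤ ε·(L^{−1∕2})^k` (10e).  Dividing by `|Λ|`:

* §1 generic: `coercive_convexComb`, `wRow_convexComb_le` ∕ `wCol_convexComb_le` (convexity of the letters), `abs_trace_mul_le_card` (`|tr(P·D)| ≤ |Λ|·R·S`
  from row sums `≤ R` of `|P|` and `|D| ≤ S`);
* §2 `interp_inv_entry_le` — generic over the socket's letters (`UniformCoercive D B γ`, `UniformCTBound D B d κ ρ ρ_B`, `ρ + ρ_B < γ`): the ENTRIES of the
  interpolated inverse obey `|M_s⁻¹(x,y)| ≤ (γ−ρ−ρ_B)⁻¹·e^{−κ d(x,y)}` for every `s ∈ [0,1]` (part 5's `inv_entry_decay_of_leaves` on the constant tower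
  `M_s − B`); on King-admissible tori in 10e's window this gives the volume-uniform ROW SUMS `≤ (4∕γ₀)·K_{d+1}(κ)` used in §3 (derived inline there, step `hrow`,
  with `tdistT_sumBound`) — 7 theorems in this file (v1.0.1, g12, docstring-only: this bullet previously named a non-existent `interp_inv_rowSum_le`;
  dag-ref-B g23 READ-743 NIT-L1; declarations byte-identical to v1.0 p573569);
* §3 ★★★ `logDetDensity_twoSpacing_rate` — `∃ w₁ A > 0`: for every volume exponent, every tower of the window and every real coupling `|t| ≤ 1`, every `k ≥ 1`:
  `|f_{k+1}(t) − f_k(t)| ≤ A·(L^{−1∕2})^k` — **THE η-RATE OF THE GAUSSIAN FREE ENERGY PER SITE, UNIFORM IN THE VOLUME** (the LEVELS' rate `L^{−1∕2}`, not its square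
  root: the trace is linear in the level difference);
* §4 ★★ `logDetDensity_limit` — hence `f_{k+1}(t)` converges as `k → ∞` with the tail `A·θ₂^{k+1}∕(1−θ₂)` uniform in the volume and in `|t| ≤ 1`.

References (method): Jacobi's formula [folklore] (tree `LogDetDerivative`, port of [AlbergoEtAl2021Fermions] App. C); finite Combes–Thomas (part 5 ∕ King (4.34));
mean-value inequality (Mathlib); King Lemma 4.3 (4.18) p.672, (4.33)–(4.34) p.674, (4.41) p.675 (A = 0).

HONEST SCOPE.  King's A = 0 SCALAR model on the King-admissible tori (odd `L ≥ 3`, `a, m² > 0`); REAL coupling; the GAUSSIAN free energy per site of the dressed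
block-spin covariance at one level — NOT the interacting vacuum energy, NOT Bałaban's `E` of [III] Thm 1, NOT King's `Z_k`; the limit is identified only as
the sequence's limit; NOT a node discharge; count-neutral.  No `sorry`, standard axioms.
-/

noncomputable section

open scoped BigOperators Matrix
open Filter Topology Metric Finset Set

namespace Summit.QuantumFields.YangMills.BalabanUVNodes.N15.KingModel

open Literature.MathematicalPhysics.QuantumFieldTheory.Balaban1983to89 hiding blockOf
open Literature.MathematicalPhysics.QuantumFieldTheory.Balaban1983to89.QGQInverse (Coercive isUnit_of_coercive)
open Literature.MathematicalPhysics.QuantumFieldTheory.Balaban1983to89.B4Sect5Proof (latticeConst latticeConst_nonneg)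
open Literature.MathematicalPhysics.QuantumFieldTheory.Balaban1983to89.B5Prop11Plancherel (Tor fine)
open Literature.MathematicalPhysics.QuantumFieldTheory.King1986 (aK aK_pos aK_le wRow wCol)
open Literature.MathematicalPhysics.QuantumFieldTheory.King1986.Torus (gam0L gam0L_pos tdistT tdistT_isPseudoDist tdistT_sumBound thetaBar)
open Literature.Analysis.Matrix.LogDetDerivative (hasDerivAt_real_log_det)
open Summit.QuantumFields.BalabanUV.T4Continuum.NE2KingTransplant (IsPseudoMetric UniformCoercive UniformCTBound)
open Summit.QuantumFields.YangMills.BalabanUVNodes.N15KingModelRung.Curved (underPtN)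

variable {d : ℕ}

/-! ## §1 Convexity of the letters and the trace bound -/

section Generic

variable {n : Type*} [Fintype n] [DecidableEq n]

omit [DecidableEq n] in
/-- **Coercivity is preserved by convex combination** (the form is linear in the operator). [folklore] -/
theorem coercive_convexComb {A A' : Matrix n n ℝ} {γ s : ℝ} (hA : Coercive A γ) (hA' : Coercive A' γ) (hs0 : 0 ≤ s) (hs1 : s ≤ 1) :
    Coercive ((1 - s) • A + s • A') γ := by
  intro x
  have h1 := hA x
  have h2 := hA' x
  rw [Matrix.add_mulVec, Matrix.smul_mulVec, Matrix.smul_mulVec, dotProduct_add, dotProduct_smul, dotProduct_smul, smul_eq_mul,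
    smul_eq_mul]
  nlinarith

omit [DecidableEq n] in
/-- **The Combes–Thomas row budget is convex**: `wRow((1−s)A + sA′) ≤ (1−s)·wRow A + s·wRow A′` for `0 ≤ s ≤ 1`, `κ ≥ 0`, `d ≥ 0`. [folklore] -/
theorem wRow_convexComb_le {A A' : Matrix n n ℝ} {dd : n → n → ℝ} {κ s ρ : ℝ} (hκ : 0 ≤ κ) (hd : ∀ i j, 0 ≤ dd i j) (hs0 : 0 ≤ s) (hs1 : s ≤ 1)
    (hA : ∀ i, wRow A dd κ i ≤ ρ) (hA' : ∀ i, wRow A' dd κ i ≤ ρ) (i : n) : wRow ((1 - s) • A + s • A') dd κ i ≤ ρ := by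
  have hw : ∀ j, 0 ≤ Real.exp (κ * dd i j) - 1 := fun j => by
    have : (1 : ℝ) ≤ Real.exp (κ * dd i j) := Real.one_le_exp (mul_nonneg hκ (hd i j))
    linarith
  calc wRow ((1 - s) • A + s • A') dd κ i = ∑ j, |(1 - s) * A i j + s * A' i j| * (Real.exp (κ * dd i j) - 1) := by
        simp only [wRow, Matrix.add_apply, Matrix.smul_apply, smul_eq_mul]
    _ ≤ ∑ j, ((1 - s) * |A i j| + s * |A' i j|) * (Real.exp (κ * dd i j) - 1) := by
        refine sum_le_sum fun j _ => mul_le_mul_of_nonneg_right ?_ (hw j)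
        calc |(1 - s) * A i j + s * A' i j| ≤ |(1 - s) * A i j| + |s * A' i j| := abs_add_le _ _
          _ = (1 - s) * |A i j| + s * |A' i j| := by rw [abs_mul, abs_mul, abs_of_nonneg (by linarith), abs_of_nonneg hs0]
    _ = (1 - s) * wRow A dd κ i + s * wRow A' dd κ i := by
        simp only [wRow, mul_sum, ← sum_add_distrib]
        refine sum_congr rfl fun j _ => by ring
    _ ≤ (1 - s) * ρ + s * ρ := add_le_add (mul_le_mul_of_nonneg_left (hA i) (by linarith)) (mul_le_mul_of_nonneg_left (hA' i) hs0)
    _ = ρ := by ring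

omit [DecidableEq n] in
/-- Column version of `wRow_convexComb_le`. [folklore] -/
theorem wCol_convexComb_le {A A' : Matrix n n ℝ} {dd : n → n → ℝ} {κ s ρ : ℝ} (hκ : 0 ≤ κ) (hd : ∀ i j, 0 ≤ dd i j) (hs0 : 0 ≤ s) (hs1 : s ≤ 1)
    (hA : ∀ j, wCol A dd κ j ≤ ρ) (hA' : ∀ j, wCol A' dd κ j ≤ ρ) (j : n) : wCol ((1 - s) • A + s • A') dd κ j ≤ ρ := by
  have hw : ∀ i, 0 ≤ Real.exp (κ * dd i j) - 1 := fun i => by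
    have : (1 : ℝ) ≤ Real.exp (κ * dd i j) := Real.one_le_exp (mul_nonneg hκ (hd i j))
    linarith
  calc wCol ((1 - s) • A + s • A') dd κ j = ∑ i, |(1 - s) * A i j + s * A' i j| * (Real.exp (κ * dd i j) - 1) := by
        simp only [wCol, Matrix.add_apply, Matrix.smul_apply, smul_eq_mul]
    _ ≤ ∑ i, ((1 - s) * |A i j| + s * |A' i j|) * (Real.exp (κ * dd i j) - 1) := by
        refine sum_le_sum fun i _ => mul_le_mul_of_nonneg_right ?_ (hw i)
        calc |(1 - s) * A i j + s * A' i j| ≤ |(1 - s) * A i j| + |s * A' i j| := abs_add_le _ _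
          _ = (1 - s) * |A i j| + s * |A' i j| := by rw [abs_mul, abs_mul, abs_of_nonneg (by linarith), abs_of_nonneg hs0]
    _ = (1 - s) * wCol A dd κ j + s * wCol A' dd κ j := by
        simp only [wCol, mul_sum, ← sum_add_distrib]
        refine sum_congr rfl fun i _ => by ring
    _ ≤ (1 - s) * ρ + s * ρ := add_le_add (mul_le_mul_of_nonneg_left (hA j) (by linarith)) (mul_le_mul_of_nonneg_left (hA' j) hs0)
    _ = ρ := by ring

omit [DecidableEq n] in
/-- **Trace bound**: `|tr(P·D)| ≤ |Λ|·R·S` if every row sum of `|P|` is `≤ R` and `|D| ≤ S` entrywise. [folklore] -/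
theorem abs_trace_mul_le_card {P D : Matrix n n ℝ} {R S : ℝ} (hS : 0 ≤ S) (hP : ∀ x, ∑ y, |P x y| ≤ R) (hD : ∀ x y, |D x y| ≤ S) :
    |(P * D).trace| ≤ Fintype.card n * (R * S) := by
  rw [Matrix.trace]
  simp only [Matrix.diag_apply, Matrix.mul_apply]
  calc |∑ x, ∑ y, P x y * D y x| ≤ ∑ x, |∑ y, P x y * D y x| := abs_sum_le_sum_abs _ _
    _ ≤ ∑ x, ∑ y, |P x y| * S := by
        refine sum_le_sum fun x _ => (abs_sum_le_sum_abs _ _).trans (sum_le_sum fun y _ => ?_)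
        rw [abs_mul]
        exact mul_le_mul_of_nonneg_left (hD y x) (abs_nonneg _)
    _ = ∑ x, (∑ y, |P x y|) * S := by refine sum_congr rfl fun x _ => ?_; rw [sum_mul]
    _ ≤ ∑ _x : n, R * S := sum_le_sum fun x _ => mul_le_mul_of_nonneg_right (hP x) hS
    _ = Fintype.card n * (R * S) := by rw [sum_const, card_univ, nsmul_eq_mul]

end Generic

/-! ## §2 The interpolated inverse has volume-uniform row sums -/

section KingU

variable (L : ℕ) [NeZero L]

/-- **Row sums of the interpolated inverse** `M_s⁻¹ = ((1−s)D_k + sD_{k+1} + B)⁻¹`, from the socket's letters for the tower `D` with block `B`: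
`UniformCoercive D B γ`, `UniformCTBound D B d κ ρ ρ_B`, `ρ + ρ_B < γ` ⇒ `|M_s⁻¹(x,y)| ≤ (γ−ρ−ρ_B)⁻¹e^{−κ d(x,y)}` for every `s ∈ [0,1]`
(part 5's `inv_entry_decay_of_leaves` on the constant tower `M_s − B`). [cite: King1986, (4.33)–(4.34) p.674 (A = 0 template)] -/
theorem interp_inv_entry_le {nn : Type} [Fintype nn] [DecidableEq nn] {D : ℕ → Matrix nn nn ℝ} {B : Matrix nn nn ℝ} {dd : nn → nn → ℝ}
    {γ κ ρ ρB s : ℝ} (hd : IsPseudoMetric dd) (hγ : ρ + ρB < γ) (hκ : 0 ≤ κ) (h1 : UniformCoercive D B γ) (h2 : UniformCTBound D B dd κ ρ ρB)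
    (hs0 : 0 ≤ s) (hs1 : s ≤ 1) (k : ℕ) (x y : nn) :
    |((1 - s) • D k + s • D (k + 1) + B)⁻¹ x y| ≤ (γ - (ρ + ρB))⁻¹ * Real.exp (-(κ * dd x y)) := by
  have hd0 : ∀ i j, 0 ≤ dd i j := fun i j => by
    have := hd.tri i j i; rw [hd.zero, hd.symm j i] at this; linarith
  obtain ⟨hr, hc, hrB, hcB⟩ := h2
  -- the constant tower `fun _ => (1−s)D_k + sD_{k+1}` carries the letters
  have h1' : UniformCoercive (fun _ : ℕ => (1 - s) • D k + s • D (k + 1)) B γ := by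
    intro j
    show Coercive ((1 - s) • D k + s • D (k + 1) + B) γ
    have e : (1 - s) • D k + s • D (k + 1) + B = (1 - s) • (D k + B) + s • (D (k + 1) + B) := by
      ext i j; simp only [Matrix.add_apply, Matrix.smul_apply, smul_eq_mul]; ring
    rw [e]
    exact coercive_convexComb (h1 k) (h1 (k + 1)) hs0 hs1
  have h2' : UniformCTBound (fun _ : ℕ => (1 - s) • D k + s • D (k + 1)) B dd κ ρ ρB :=
    ⟨fun _ i => wRow_convexComb_le hκ hd0 hs0 hs1 (hr k) (hr (k + 1)) i, fun _ j => wCol_convexComb_le hκ hd0 hs0 hs1 (hc k) (hc (k + 1)) j, hrB, hcB⟩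
  exact inv_entry_decay_of_leaves hd hγ hκ h1' h2' 0 x y

/-! ## §3 The η-rate of the free-energy density -/

/-- ★★★ **THE η-RATE OF THE GAUSSIAN FREE ENERGY PER SITE, UNIFORMLY IN THE VOLUME.**  For odd `L ≥ 3`, `a, m² > 0` there are `w₁, A > 0` such that for every
volume exponent `e`, every potential tower `v` with `sup|v_N| ≤ w₀ ≤ w₁`, coherence defect `≤ ν₀s^k` (`0 ≤ ν₀ ≤ w₁`, `0 ≤ s ≤ L^{−1∕2}`), every real coupling
`|t| ≤ 1` and every `k ≥ 1`, with `f_j(t) := |Λ|⁻¹·log det(Δ^{(j)}_{t·v} + aL⁻²Q*Q)` (41's `logDetDensity j (v (L^j)) t`):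
`|f_{k+1}(t) − f_k(t)| ≤ A·(L^{−1∕2})^k` — every constant independent of `k`, of the volume and of `v`
(interpolation `M_s`, Jacobi `d∕ds log det M_s = tr(M_s⁻¹(Δ^{(k+1)} − Δ^{(k)}))`, §2's row sums `≤ (4∕γ₀)K_{d+1}(κ)`, the dressed leaf (H3) `≤ ε·(L^{−1∕2})^k`, the
mean-value inequality on `[0,1]`, division by `|Λ|`).
[cite: King1986, Lemma 4.3 (4.18) p.672, (4.33)–(4.34) p.674, (4.41) p.675 (A = 0 template); AlbergoEtAl2021Fermions, App. C (Jacobi's formula, the tree's port)] -/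
theorem logDetDensity_twoSpacing_rate (hLodd : Odd L) (hL : 2 ≤ L) {a m2 : ℝ} (ha : 0 < a) (hm : 0 < m2) :
    ∃ w₁ A : ℝ, 0 < w₁ ∧ 0 < A ∧
      ∀ (e : ℕ) (v : ∀ N : ℕ, Tor (fine N (kingU d L e)) → ℝ) (w₀ ν₀ s : ℝ),
      0 ≤ ν₀ → ν₀ ≤ w₁ → 0 ≤ s → s ≤ (L : ℝ) ^ (-(1 / 2 : ℝ)) →
      (∀ (N : ℕ) (x : Tor (fine N (kingU d L e))), |v N x| ≤ w₀) → w₀ ≤ w₁ →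
      (∀ (k : ℕ), 1 ≤ k → ∀ x' : Tor (fine (L ^ 1 * L ^ k) (kingU d L e)),
          |v (L ^ 1 * L ^ k) x' - v (L ^ k) (underPtN L k 1 (kingU d L e) x')| ≤ ν₀ * s ^ k) →
      ∀ (t : ℝ), |t| ≤ 1 → ∀ k : ℕ, 1 ≤ k →
        |logDetDensity a m2 L (kingM d L e) (k + 1) (v (L ^ (k + 1))) t - logDetDensity a m2 L (kingM d L e) k (v (L ^ k)) t|
          ≤ A * (((L : ℝ) ^ (-(1 / 2 : ℝ))) ^ k) := by
  obtain ⟨κ, c₁, V, w₁, hκ, hc₁, hV, hw₁, hgap8, HD⟩ := dressedLeaves_fullPert (d := d) L hLodd hL ha hm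
  have hγ := gam0L_pos (d := d + 1) ha hL
  have hρ := kingRho_add_le (dd := d + 1) ha hL
  have hθb := thetaBar_mul_nonneg (a := a) ha hL
  set γ₀ := gam0L (d + 1) a L with hγ₀
  set E : ℝ := thetaBar a L * a + c₁ * (w₁ + w₁) + 1 with hE
  have hE0 : 0 < E := by positivity
  set A : ℝ := 4 / γ₀ * latticeConst (d + 1) κ * E with hA
  have hK0 : 0 < latticeConst (d + 1) κ := latticeConst_pos (d + 1) hκ
  refine ⟨w₁, A, hw₁, by positivity, ?_⟩
  intro e v w₀ ν₀ s hν₀ hν₁ hs0 hs1 hv hw₁' hcoh t ht k hk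
  -- the dressed tower at the real coupling t·v and its leaves
  have hvt : ∀ (N : ℕ) (x : Tor (fine N (kingU d L e))), |(t • v) N x| ≤ |t| * w₀ := by
    intro N x'
    show |t * v N x'| ≤ |t| * w₀
    rw [abs_mul]
    exact mul_le_mul_of_nonneg_left (hv N x') (abs_nonneg t)
  have hcoht : ∀ (k : ℕ), 1 ≤ k → ∀ x' : Tor (fine (L ^ 1 * L ^ k) (kingU d L e)),
      |(t • v) (L ^ 1 * L ^ k) x' - (t • v) (L ^ k) (underPtN L k 1 (kingU d L e) x')| ≤ (|t| * ν₀) * s ^ k := by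
    intro k hk x'
    show |t * v (L ^ 1 * L ^ k) x' - t * v (L ^ k) (underPtN L k 1 (kingU d L e) x')| ≤ (|t| * ν₀) * s ^ k
    rw [← mul_sub, abs_mul, mul_assoc]
    exact mul_le_mul_of_nonneg_left (hcoh k hk x') (abs_nonneg t)
  have hw0 : 0 ≤ w₀ := (abs_nonneg _).trans (hv 1 (fun _ => 0))
  have htw : |t| * w₀ ≤ w₁ := by nlinarith [abs_nonneg t]
  have htν : |t| * ν₀ ≤ w₁ := by nlinarith [abs_nonneg t]
  obtain ⟨g1, g2, -, g3, -⟩ := HD e (t • v) (|t| * w₀) (|t| * ν₀) s (by positivity) htν hs0 hs1 hvt htw hcoht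
  set Dt : ℕ → Matrix (Tor (kingU d L e)) (Tor (kingU d L e)) ℝ := kingTower a m2 L (kingM d L e) + fullPert a m2 L (kingM d L e) (t • v) with hDt
  set Bk : Matrix (Tor (kingU d L e)) (Tor (kingU d L e)) ℝ := kingBlock a L (kingM d L e) with hBk
  have hwV : |t| * w₀ * c₁ * V ≤ γ₀ / 8 := (mul_le_mul_of_nonneg_right (mul_le_mul_of_nonneg_right htw hc₁.le) hV.le).trans hgap8
  have hgap : kingRho (d + 1) a L + |t| * w₀ * c₁ * V + kingRhoB (d + 1) a L < γ₀ - |t| * w₀ * c₁ * V := by linarith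
  have hmar : (γ₀ - |t| * w₀ * c₁ * V - (kingRho (d + 1) a L + |t| * w₀ * c₁ * V + kingRhoB (d + 1) a L))⁻¹ ≤ 4 / γ₀ := by
    have h2 : (γ₀ - |t| * w₀ * c₁ * V - (kingRho (d + 1) a L + |t| * w₀ * c₁ * V + kingRhoB (d + 1) a L))⁻¹ ≤ (γ₀ / 4)⁻¹ :=
      inv_anti₀ (by positivity) (by linarith)
    rwa [inv_div] at h2
  have hpos : 0 < γ₀ - |t| * w₀ * c₁ * V := by linarith
  -- the levels k, k+1 along the run
  have hk1 : 1 ≤ k + 1 := Nat.succ_le_succ (Nat.zero_le k)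
  have hDk : Dt k = kingLevelPot a m2 L (kingM d L e) k (t • v (L ^ k)) := by
    rw [hDt, kingTower_add_fullPert, kingTowerPot_of_one_le _ hk]; rfl
  have hDk1 : Dt (k + 1) = kingLevelPot a m2 L (kingM d L e) (k + 1) (t • v (L ^ (k + 1))) := by
    rw [hDt, kingTower_add_fullPert, kingTowerPot_of_one_le _ hk1]; rfl
  -- the interpolation and Jacobi
  set M : ℝ → Matrix (Tor (kingU d L e)) (Tor (kingU d L e)) ℝ := fun u => (1 - u) • Dt k + u • Dt (k + 1) + Bk with hM
  have hMderiv : ∀ u, ∀ i j, HasDerivAt (fun u' : ℝ => M u' i j) ((Dt (k + 1) - Dt k) i j) u := by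
    intro u i j
    have h1 : HasDerivAt (fun u' : ℝ => (1 - u') * Dt k i j) (-1 * Dt k i j) u :=
      ((hasDerivAt_id u).const_sub 1).mul_const (Dt k i j)
    have h2 : HasDerivAt (fun u' : ℝ => u' * Dt (k + 1) i j + Bk i j) (1 * Dt (k + 1) i j) u :=
      ((hasDerivAt_id u).mul_const (Dt (k + 1) i j)).add_const (Bk i j)
    have h := h1.add h2
    have e : (fun u' : ℝ => M u' i j) = fun u' => (1 - u') * Dt k i j + (u' * Dt (k + 1) i j + Bk i j) := by
      funext u'
      simp only [hM, Matrix.add_apply, Matrix.smul_apply, smul_eq_mul]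
      ring
    rw [e, Matrix.sub_apply, show Dt (k + 1) i j - Dt k i j = -1 * Dt k i j + 1 * Dt (k + 1) i j by ring]
    exact h
  have hdet : ∀ u, 0 ≤ u → u ≤ 1 → (M u).det ≠ 0 := by
    intro u hu0 hu1
    have hc : Coercive (M u) (γ₀ - |t| * w₀ * c₁ * V) := by
      have e : M u = (1 - u) • (Dt k + Bk) + u • (Dt (k + 1) + Bk) := by
        ext i j; simp only [hM, Matrix.add_apply, Matrix.smul_apply, smul_eq_mul]; ring
      rw [e]
      exact coercive_convexComb (g1 k) (g1 (k + 1)) hu0 hu1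
    exact ((Matrix.isUnit_iff_isUnit_det _).mp (isUnit_of_coercive hpos hc)).ne_zero
  -- the derivative bound on [0,1]
  have hsup : ∀ x y, |(Dt (k + 1) - Dt k) x y| ≤ E * ((L : ℝ) ^ (-(1 / 2 : ℝ))) ^ k := by
    intro x y
    have h := g3 k x y
    refine h.trans (mul_le_mul_of_nonneg_right ?_ (pow_nonneg (Real.rpow_nonneg (Nat.cast_nonneg _) _) k))
    have : c₁ * (|t| * w₀ + |t| * ν₀) ≤ c₁ * (w₁ + w₁) := mul_le_mul_of_nonneg_left (by linarith) hc₁.le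
    linarith
  have hrow : ∀ u, 0 ≤ u → u ≤ 1 → ∀ x, ∑ y, |(M u)⁻¹ x y| ≤ 4 / γ₀ * latticeConst (d + 1) κ := by
    intro u hu0 hu1 x
    have hent : ∀ y, |(M u)⁻¹ x y| ≤ 4 / γ₀ * Real.exp (-(κ * tdistT (kingU d L e) x y)) := by
      intro y
      have h := interp_inv_entry_le (isPseudoMetric_tdistT (kingU d L e)) hgap hκ.le g1 g2 hu0 hu1 k x y
      exact h.trans (mul_le_mul_of_nonneg_right hmar (Real.exp_pos _).le)
    calc ∑ y, |(M u)⁻¹ x y| ≤ ∑ y, 4 / γ₀ * Real.exp (-(κ * tdistT (kingU d L e) x y)) := sum_le_sum fun y _ => hent y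
      _ = 4 / γ₀ * ∑ y, Real.exp (-(κ * tdistT (kingU d L e) x y)) := by rw [mul_sum]
      _ ≤ 4 / γ₀ * latticeConst (d + 1) κ := mul_le_mul_of_nonneg_left (tdistT_sumBound (kingU d L e) κ hκ x) (by positivity)
  set n : ℕ := Fintype.card (Tor (kingU d L e)) with hn
  have hn0 : (0 : ℝ) < n := by exact_mod_cast (Fintype.card_pos : 0 < n)
  have hF : ∀ u ∈ Icc (0 : ℝ) 1, HasDerivWithinAt (fun u' : ℝ => Real.log (M u').det) (((M u)⁻¹ * (Dt (k + 1) - Dt k)).trace) (Icc (0 : ℝ) 1) u :=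
    fun u hu => (hasDerivAt_real_log_det (hMderiv u) (hdet u hu.1 hu.2)).hasDerivWithinAt
  have hbound : ∀ u ∈ Ico (0 : ℝ) 1, ‖((M u)⁻¹ * (Dt (k + 1) - Dt k)).trace‖ ≤ n * (4 / γ₀ * latticeConst (d + 1) κ * (E * ((L : ℝ) ^ (-(1 / 2 : ℝ))) ^ k)) := by
    intro u hu
    rw [Real.norm_eq_abs]
    exact abs_trace_mul_le_card (by positivity) (hrow u hu.1 hu.2.le) hsup
  have hMVT := norm_image_sub_le_of_norm_deriv_le_segment_01' hF hbound
  -- read the endpoints as the two densities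
  have hM1 : M 1 = Dt (k + 1) + Bk := by simp only [hM, sub_self, zero_smul, one_smul, zero_add]
  have hM0 : M 0 = Dt k + Bk := by simp only [hM, sub_zero, one_smul, zero_smul, add_zero]
  have hf1 : logDetDensity a m2 L (kingM d L e) (k + 1) (v (L ^ (k + 1))) t = (n : ℝ)⁻¹ * Real.log (M 1).det := by
    rw [logDetDensity, hM1, hDk1]
  have hf0 : logDetDensity a m2 L (kingM d L e) k (v (L ^ k)) t = (n : ℝ)⁻¹ * Real.log (M 0).det := by
    rw [logDetDensity, hM0, hDk]
  rw [hf1, hf0, ← mul_sub, abs_mul, abs_inv, Nat.abs_cast]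
  rw [Real.norm_eq_abs] at hMVT
  calc (n : ℝ)⁻¹ * |Real.log (M 1).det - Real.log (M 0).det|
      ≤ (n : ℝ)⁻¹ * (n * (4 / γ₀ * latticeConst (d + 1) κ * (E * ((L : ℝ) ^ (-(1 / 2 : ℝ))) ^ k))) :=
        mul_le_mul_of_nonneg_left hMVT (inv_nonneg.mpr hn0.le)
    _ = A * ((L : ℝ) ^ (-(1 / 2 : ℝ))) ^ k := by rw [← mul_assoc, inv_mul_cancel₀ hn0.ne', one_mul, hA]; ring

/-! ## §4 The limit of the free-energy density -/

/-- ★★ **THE GAUSSIAN FREE ENERGY PER SITE CONVERGES AS `k → ∞`, WITH A GEOMETRIC TAIL UNIFORM IN THE VOLUME AND IN `|t| ≤ 1`.**  With the data of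
`logDetDensity_twoSpacing_rate` (`θ₂ = L^{−1∕2}`): the sequence `k ↦ f_{k+1}(t)` converges and `|f_{k+1}(t) − lim| ≤ A·θ₂^{k+1}∕(1−θ₂)` for every `k`
(Mathlib `cauchySeq_of_le_geometric`, `dist_le_of_le_geometric_of_tendsto`). [cite: King1986, §4 pp.675–676, (4.41) p.675 (A = 0 template)] -/
theorem logDetDensity_limit (hLodd : Odd L) (hL : 2 ≤ L) {a m2 : ℝ} (ha : 0 < a) (hm : 0 < m2) :
    ∃ w₁ A : ℝ, 0 < w₁ ∧ 0 < A ∧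
      ∀ (e : ℕ) (v : ∀ N : ℕ, Tor (fine N (kingU d L e)) → ℝ) (w₀ ν₀ s : ℝ),
      0 ≤ ν₀ → ν₀ ≤ w₁ → 0 ≤ s → s ≤ (L : ℝ) ^ (-(1 / 2 : ℝ)) →
      (∀ (N : ℕ) (x : Tor (fine N (kingU d L e))), |v N x| ≤ w₀) → w₀ ≤ w₁ →
      (∀ (k : ℕ), 1 ≤ k → ∀ x' : Tor (fine (L ^ 1 * L ^ k) (kingU d L e)),
          |v (L ^ 1 * L ^ k) x' - v (L ^ k) (underPtN L k 1 (kingU d L e) x')| ≤ ν₀ * s ^ k) →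
      ∀ (t : ℝ), |t| ≤ 1 →
        let fS : ℕ → ℝ := fun k => logDetDensity a m2 L (kingM d L e) (k + 1) (v (L ^ (k + 1))) t
        let θ₂ : ℝ := (L : ℝ) ^ (-(1 / 2 : ℝ))
        Tendsto fS atTop (𝓝 (limUnder atTop fS)) ∧ ∀ k : ℕ, |fS k - limUnder atTop fS| ≤ (A * θ₂) * θ₂ ^ k / (1 - θ₂) := by
  obtain ⟨w₁, A, hw₁, hA, H⟩ := logDetDensity_twoSpacing_rate (d := d) L hLodd hL ha hm
  refine ⟨w₁, A, hw₁, hA, ?_⟩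
  intro e v w₀ ν₀ s hν₀ hν₁ hs0 hs1 hv hw₁' hcoh t ht fS θ₂
  have hθ0 : 0 ≤ θ₂ := Real.rpow_nonneg (Nat.cast_nonneg _) _
  have hθ1 : θ₂ < 1 := by
    have hL1 : (1 : ℝ) < L := by exact_mod_cast (by omega : 1 < L)
    exact Real.rpow_lt_one_of_one_lt_of_neg hL1 (by norm_num)
  have hstep : ∀ k, dist (fS k) (fS (k + 1)) ≤ (A * θ₂) * θ₂ ^ k := by
    intro k
    rw [dist_eq_norm, ← norm_neg, neg_sub, Real.norm_eq_abs]
    have h := H e v w₀ ν₀ s hν₀ hν₁ hs0 hs1 hv hw₁' hcoh t ht (k + 1) (Nat.succ_le_succ (Nat.zero_le k))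
    calc |fS (k + 1) - fS k| = |logDetDensity a m2 L (kingM d L e) (k + 1 + 1) (v (L ^ (k + 1 + 1))) t
          - logDetDensity a m2 L (kingM d L e) (k + 1) (v (L ^ (k + 1))) t| := rfl
      _ ≤ A * θ₂ ^ (k + 1) := h
      _ = (A * θ₂) * θ₂ ^ k := by rw [pow_succ]; ring
  have hcauchy : CauchySeq fS := cauchySeq_of_le_geometric θ₂ (A * θ₂) hθ1 hstep
  have hlim : Tendsto fS atTop (𝓝 (limUnder atTop fS)) := hcauchy.tendsto_limUnder
  refine ⟨hlim, fun k => ?_⟩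
  have key := dist_le_of_le_geometric_of_tendsto θ₂ (A * θ₂) hθ1 hstep hlim k
  rwa [Real.dist_eq] at key

end KingU

end Summit.QuantumFields.YangMills.BalabanUVNodes.N15.KingModel

end
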